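import Mathlib
import HarnessLib
import Summits.ValiantsHypothesis.ValiantsHypothesis.Theorems.EquivariantDialLayersDegOne
import Summits.ValiantsHypothesis.ValiantsHypothesis.Theorems.EquivariantDialLayersToyTransfer

/-!
# Equivariant dial, layered face — cuts of `per_m`: the `ζ`-eigenvector and the first cut

Support for the cell `A = EqHardBiPerm` (item `stmt-ValiantsHypothesis-23702`, draft route `SymmetryDial`)
via its layered leaf `R^lay = IdealWidthSuperpoly` (`EquivariantDialLayers`: `idealWidth (biPermSubst m)
per_m d` = least number of degree-`d` forms with window-stable span whose ideal contains `per_m`;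
window = `𝔖_m × 𝔖_m`).  HONEST FRAMING: `VP ≠ VNP` is NOT proved here, nor `A`, nor `R^lay`, nor any
super-polynomial bound — two SIZE-FREE rungs ON the leaf, every `m`, elementary / folklore-grade, new
only as kernel theorems here; NO new definitions, 0 stubs, 0 named facts, 0 summit-currency.
* §1 `DF₁`: `D_ζ = diag(ζ^i)` (`ζ` primitive `m`-th root of unity) is a `ζ`-eigenvector of the simultaneous
  cyclic shift `(c, c)` of rows and columns, so `per_m ∉ ⟨window-(even `(c,c)`-)invariant forms of degree
  1 … m-1⟩` and every window-stable cut of `per_m` in degree `0 < d < m` contains a form moved by `(c, c)`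
  (`perPoly_not_mem_span_windowInvariantLowForms`, `exists_linSubst_ne_of_hasIdealWidthLE`).
* §2 `idealWidth (biPermSubst m) per_m 1 = m²` for `1 ≤ m` (`idealWidth_perPoly_one_eq`; upper bound from
  `EquivariantDialLayersDegOne`), through `exists_permanent_ne_zero_of_submatrix_stable`: `per_m` vanishes
  identically on NO non-zero subspace of matrices stable under `A ↦ A.submatrix σ τ` (swap-differences and
  symmetrising sums inside the subspace reach a rank-one `u vᵀ` with `per = m! ∏u ∏v ≠ 0`) + rank–nullity.
  Contrast: WITHOUT window-stability the minimum is `m`, not `m²` (`ChanIlten.le_of_perPoly_mem_span`,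
  Chan–Ilten 2015, Prop. 2.6, in `Literature/AlgebraicGeometry/DeterminantalHypersurfaces`; not imported).
Reused by import, not restated: `exists_mem_biPermSubst_prodCongr`, `permMatrix_mem_permSubst`,
`linSubst_permMatrix`, `eval_perPoly`, `eval_smul_of_isHomogeneous`, `eval_eq_of_totalDegree_le_one`,
`hasIdealWidthLE_perPoly_one`, `idealWidth_perPoly_one_le`.
-/

set_option linter.dupNamespace false

namespace Summit.ValiantsHypothesis.ValiantsHypothesis.Theorems.EquivariantDialLayersCuts

open MvPolynomial Matrix Literature.Computability.AlgebraicComplexity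
open Summit.ValiantsHypothesis.ValiantsHypothesis.Theorems.EquivariantDialNode
open Summit.ValiantsHypothesis.ValiantsHypothesis.Theorems.EquivariantDialLayers
open Summit.ValiantsHypothesis.ValiantsHypothesis.Theorems.EquivariantDialLayersToy

noncomputable section

/-- Evaluation kills the `ℂ`-span of a set of polynomials it kills. -/
private theorem eval_eq_zero_of_mem_submoduleSpan {σ : Type*} {x : σ → ℂ}
    {S : Set (MvPolynomial σ ℂ)} (hS : ∀ q ∈ S, eval x q = 0) {q : MvPolynomial σ ℂ}
    (hq : q ∈ Submodule.span ℂ S) : eval x q = 0 := by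
  induction hq using Submodule.span_induction with
  | mem q h => exact hS q h
  | zero => exact map_zero _
  | add q q' _ _ h h' => rw [map_add, h, h', add_zero]
  | smul c q _ h => rw [smul_eval, h, mul_zero]

/-- Evaluation kills the ideal generated by a set of polynomials it kills. -/
private theorem eval_eq_zero_of_mem_idealSpan {σ : Type*} {x : σ → ℂ} {S : Set (MvPolynomial σ ℂ)}
    (hS : ∀ q ∈ S, eval x q = 0) {q : MvPolynomial σ ℂ} (hq : q ∈ Ideal.span S) : eval x q = 0 :=
  RingHom.mem_ker.mp
    ((Ideal.span_le (I := RingHom.ker (eval x))).mpr (fun q h => RingHom.mem_ker.mpr (hS q h)) hq)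

/-! ## §1 The `ζ`-eigenvector: cuts below degree `m` are never made of invariants -/

/-- Eigenvector vanishing: if `x ∘ e = c • x` and `c ^ d ≠ 1`, every `e`-invariant form of degree `d`
vanishes at `x` (`g(x) = g(x ∘ e) = g(c • x) = c^d g(x)`). -/
theorem eval_eq_zero_of_comp_eq_smul {σ : Type*} {x : σ → ℂ} {e : σ → σ} {c : ℂ} {d : ℕ}
    {g : MvPolynomial σ ℂ} (hx : x ∘ e = c • x) (hg : g.IsHomogeneous d) (hc : c ^ d ≠ 1)
    (hinv : rename e g = g) : eval x g = 0 := by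
  have h1 : eval x g = c ^ d * eval x g := by
    conv_lhs => rw [← hinv, eval_rename, hx, eval_smul_of_isHomogeneous hg]
  have h2 : (c ^ d - 1) * eval x g = 0 := by linear_combination (-1 : ℂ) * h1
  exact (mul_eq_zero.mp h2).resolve_left (sub_ne_zero.mpr hc)

/-- Entrywise: `D_ζ (c i, c j) = ζ · D_ζ (i, j)` for `D_ζ (i, j) = [i = j] ζ^i`, `c = finRotate`, `ζ^(n+1) = 1`. -/
private theorem diag_finRotate {n : ℕ} {ζ : ℂ} (hζ : ζ ^ (n + 1) = 1) (i j : Fin (n + 1)) :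
    (if finRotate (n + 1) i = finRotate (n + 1) j
        then ζ ^ ((finRotate (n + 1) i : Fin (n + 1)) : ℕ) else (0 : ℂ)) =
      ζ * (if i = j then ζ ^ (i : ℕ) else 0) := by
  simp only [(finRotate (n + 1)).injective.eq_iff]
  by_cases h : i = j
  · rw [if_pos h, if_pos h, h, coe_finRotate]
    by_cases hl : j = Fin.last n
    · rw [if_pos hl, hl, Fin.val_last, pow_zero, ← pow_succ', hζ]
    · rw [if_neg hl, pow_succ']
  · rw [if_neg h, if_neg h, mul_zero]

/-- `D_ζ = diag(ζ⁰, …, ζ^{m-1})` is a `ζ`-eigenvector of the simultaneous cyclic shift `(c, c)` of rows and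
columns: `D_ζ ∘ (c, c) = ζ • D_ζ` (needs `ζ ^ m = 1`). -/
theorem diag_comp_biShift {m : ℕ} {ζ : ℂ} (hζ : ζ ^ m = 1) :
    (fun ij : Fin m × Fin m => if ij.1 = ij.2 then ζ ^ (ij.1 : ℕ) else (0 : ℂ)) ∘
        Prod.map (finRotate m) (finRotate m) =
      ζ • fun ij : Fin m × Fin m => if ij.1 = ij.2 then ζ ^ (ij.1 : ℕ) else (0 : ℂ) := by
  funext ij
  obtain ⟨i, j⟩ := ij
  rw [Function.comp_apply, Pi.smul_apply, smul_eq_mul]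
  cases m with
  | zero => exact i.elim0
  | succ n => exact diag_finRotate hζ i j

/-- `per_m (D_ζ) = ∏ ζ^i`. -/
theorem eval_diag_perPoly (m : ℕ) (ζ : ℂ) :
    eval (fun ij : Fin m × Fin m => if ij.1 = ij.2 then ζ ^ (ij.1 : ℕ) else (0 : ℂ)) (perPoly (Fin m) ℂ) =
      ∏ i : Fin m, ζ ^ (i : ℕ) := by
  rw [eval_perPoly, ← permanent_diagonal]
  exact congrArg Matrix.permanent (Matrix.ext fun i j => by simp [diagonal_apply])

/-- **`DF₁` (ideal form).** `per_m ∉ ⟨forms of degree 1 … m-1 invariant under the bi-shift (c, c)⟩`, every `m`: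
they all vanish at `D_ζ` (`ζ` a primitive `m`-th root of unity), `per_m` does not. -/
theorem perPoly_not_mem_span_shiftInvariantLowForms (m : ℕ) :
    perPoly (Fin m) ℂ ∉ Ideal.span {g : MvPolynomial (Fin m × Fin m) ℂ |
      ∃ d, 0 < d ∧ d < m ∧ g.IsHomogeneous d ∧ rename (Prod.map (finRotate m) (finRotate m)) g = g} := by
  intro hmem
  obtain ⟨ζ, hζm, hζ0⟩ : ∃ ζ : ℂ, (0 < m → IsPrimitiveRoot ζ m) ∧ ζ ≠ 0 :=
    ⟨Complex.exp (2 * Real.pi * Complex.I / m), fun hm => Complex.isPrimitiveRoot_exp m hm.ne',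
      Complex.exp_ne_zero _⟩
  refine (Finset.prod_ne_zero_iff (s := Finset.univ) (f := fun i : Fin m => ζ ^ (i : ℕ))).mpr
    (fun i _ => pow_ne_zero _ hζ0) ?_
  rw [← eval_diag_perPoly m ζ]
  refine eval_eq_zero_of_mem_idealSpan ?_ hmem
  rintro g ⟨d, hd0, hdm, hg, hinv⟩
  exact eval_eq_zero_of_comp_eq_smul (diag_comp_biShift (hζm (hd0.trans hdm)).pow_eq_one) hg
    ((hζm (hd0.trans hdm)).pow_ne_one_of_pos_of_lt hd0.ne' hdm) hinv

/-- Hence `per_m ∉ ⟨WINDOW-invariant forms of degree 1 … m-1⟩` (the bi-shift lies in the window). -/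
theorem perPoly_not_mem_span_windowInvariantLowForms (m : ℕ) :
    perPoly (Fin m) ℂ ∉ Ideal.span {g : MvPolynomial (Fin m × Fin m) ℂ |
      ∃ d, 0 < d ∧ d < m ∧ g.IsHomogeneous d ∧ ∀ γ ∈ biPermSubst m,
        linSubst (Fin m × Fin m) ℂ (γ : Matrix (Fin m × Fin m) (Fin m × Fin m) ℂ) g = g} := by
  obtain ⟨γ, hγ, hγe⟩ := exists_mem_biPermSubst_prodCongr (m := m) (finRotate m).symm
  refine fun h => perPoly_not_mem_span_shiftInvariantLowForms m (Ideal.span_mono ?_ h)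
  rintro g ⟨d, hd0, hdm, hg, hinv⟩
  refine ⟨d, hd0, hdm, hg, ?_⟩
  have h1 := hinv γ hγ
  rw [hγe, linSubst_permMatrix] at h1
  simpa only [Equiv.prodCongr_symm, Equiv.symm_symm, Equiv.prodCongr_apply] using h1

/-- **`DF₁` (cut form).** Degree-`d` forms, `0 < d < m`, cutting out `per_m` include one moved by `(c,c)`. -/
theorem exists_rename_ne_of_mem_span {m d : ℕ} (hd0 : 0 < d) (hdm : d < m)
    {s : Finset (MvPolynomial (Fin m × Fin m) ℂ)} (hhom : ∀ p ∈ s, p.IsHomogeneous d)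
    (hmem : perPoly (Fin m) ℂ ∈ Ideal.span (s : Set (MvPolynomial (Fin m × Fin m) ℂ))) :
    ∃ p ∈ s, rename (Prod.map (finRotate m) (finRotate m)) p ≠ p := by
  by_contra h
  push Not at h
  refine perPoly_not_mem_span_shiftInvariantLowForms m (Ideal.span_mono (fun p hp => ?_) hmem)
  exact ⟨d, hd0, hdm, hhom p hp, h p hp⟩

/-- Hence the head set of a cut witnessing `HasIdealWidthLE (biPermSubst m) per_m d r`, `0 < d < m`,
contains a form moved by a window element: the window module of a cut is never trivial. -/
theorem exists_linSubst_ne_of_hasIdealWidthLE {m d : ℕ} (hd0 : 0 < d) (hdm : d < m)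
    {s : Finset (MvPolynomial (Fin m × Fin m) ℂ)} (hhom : ∀ p ∈ s, p.IsHomogeneous d)
    (hmem : perPoly (Fin m) ℂ ∈ Ideal.span (s : Set (MvPolynomial (Fin m × Fin m) ℂ))) :
    ∃ p ∈ s, ∃ γ ∈ biPermSubst m,
      linSubst (Fin m × Fin m) ℂ (γ : Matrix (Fin m × Fin m) (Fin m × Fin m) ℂ) p ≠ p := by
  obtain ⟨p, hp, hne⟩ := exists_rename_ne_of_mem_span hd0 hdm hhom hmem
  obtain ⟨γ, hγ, hγe⟩ := exists_mem_biPermSubst_prodCongr (m := m) (finRotate m).symm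
  refine ⟨p, hp, γ, hγ, ?_⟩
  rw [hγe, linSubst_permMatrix]
  simpa only [Equiv.prodCongr_symm, Equiv.symm_symm, Equiv.prodCongr_apply] using hne

/-! ## §2 The first cut is everything: `idealWidth (biPermSubst m) per_m 1 = m²` -/

/-- Permanent of a rank-one matrix: `per (v wᵀ) = n! · ∏ v · ∏ w`. -/
theorem permanent_vecMulVec {n : Type*} [Fintype n] [DecidableEq n] (v w : n → ℂ) :
    (vecMulVec v w).permanent = (Fintype.card n).factorial * ((∏ i, v i) * ∏ j, w j) := by
  simp only [Matrix.permanent, vecMulVec_apply, Finset.prod_mul_distrib]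
  have h : ∀ σ : Equiv.Perm n, (∏ i, v (σ i)) = ∏ i, v i := fun σ => Equiv.prod_comp σ v
  simp_rw [h, Finset.sum_const, Finset.card_univ, Fintype.card_perm, nsmul_eq_mul]

/-- `A - (rows p, q of A swapped) = (e_p - e_q) (A_p - A_q)ᵀ`. -/
theorem sub_submatrix_swap_left {ι : Type*} [DecidableEq ι] (A : Matrix ι ι ℂ) (p q : ι) :
    A - A.submatrix (Equiv.swap p q) (Equiv.refl ι) =
      vecMulVec (Pi.single p 1 - Pi.single q 1) (fun j => A p j - A q j) := by
  ext i j
  simp only [Matrix.sub_apply, submatrix_apply, Equiv.refl_apply, vecMulVec_apply, Pi.sub_apply,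
    Pi.single_apply]
  by_cases hip : i = p
  · rw [if_pos hip, hip]
    by_cases hpq : p = q
    · rw [if_pos hpq, hpq, Equiv.swap_self, Equiv.refl_apply]; ring
    · rw [if_neg hpq, Equiv.swap_apply_left]; ring
  · rw [if_neg hip]
    by_cases hiq : i = q
    · rw [if_pos hiq, hiq, Equiv.swap_apply_right]; ring
    · rw [if_neg hiq, Equiv.swap_apply_of_ne_of_ne hip hiq]; ring

/-- `A - (columns p, q of A swapped) = (A^p - A^q) (e_p - e_q)ᵀ` (transpose of the previous). -/
theorem sub_submatrix_swap_right {ι : Type*} [DecidableEq ι] (A : Matrix ι ι ℂ) (p q : ι) :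
    A - A.submatrix (Equiv.refl ι) (Equiv.swap p q) =
      vecMulVec (fun i => A i p - A i q) (Pi.single p 1 - Pi.single q 1) := by
  rw [← transpose_inj, transpose_sub, transpose_submatrix, transpose_vecMulVec]
  exact sub_submatrix_swap_left Aᵀ p q

/-- Column symmetrisation (`p ≠ q`): `∑_{a ≠ q} (v (e_p - e_q)ᵀ)^{(p a)} = v u_qᵀ`, `u_q = 𝟙 - (n+1) e_q`. -/
theorem sum_vecMulVec_submatrix_swap_right {n : ℕ} (v : Fin (n + 1) → ℂ) {p q : Fin (n + 1)}
    (hpq : p ≠ q) :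
    ∑ a ∈ Finset.univ.erase q,
        (vecMulVec v (Pi.single p 1 - Pi.single q 1)).submatrix (Equiv.refl _) (Equiv.swap p a) =
      vecMulVec v (fun j => if j = q then -(n : ℂ) else 1) := by
  ext i j
  rw [Matrix.sum_apply]
  simp only [submatrix_apply, Equiv.refl_apply, vecMulVec_apply, Pi.sub_apply, Pi.single_apply,
    ← Finset.mul_sum]
  congr 1
  have key : ∀ a ∈ Finset.univ.erase q,
      ((if Equiv.swap p a j = p then (1 : ℂ) else 0) - if Equiv.swap p a j = q then (1 : ℂ) else 0) =
        (if j = a then (1 : ℂ) else 0) - if j = q then (1 : ℂ) else 0 := by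
    intro a ha
    have haq : a ≠ q := Finset.ne_of_mem_erase ha
    simp only [Equiv.swap_apply_eq_iff, Equiv.swap_apply_left,
      Equiv.swap_apply_of_ne_of_ne hpq.symm haq.symm]
  rw [Finset.sum_congr rfl key]
  simp only [Finset.sum_sub_distrib, Finset.sum_ite_eq, Finset.sum_const,
    Finset.card_erase_of_mem (Finset.mem_univ q), Finset.card_univ, Fintype.card_fin,
    Nat.add_sub_cancel, nsmul_eq_mul]
  by_cases hj : j = q <;> simp [hj]

/-- Row symmetrisation (transpose of the previous): `∑_{a ≠ q} ((e_p - e_q) wᵀ)_{(p a)} = u_q wᵀ`. -/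
theorem sum_vecMulVec_submatrix_swap_left {n : ℕ} (w : Fin (n + 1) → ℂ) {p q : Fin (n + 1)}
    (hpq : p ≠ q) :
    ∑ a ∈ Finset.univ.erase q,
        (vecMulVec (Pi.single p 1 - Pi.single q 1) w).submatrix (Equiv.swap p a) (Equiv.refl _) =
      vecMulVec (fun i => if i = q then -(n : ℂ) else 1) w := by
  rw [← transpose_inj]
  simp only [transpose_sum, transpose_submatrix, transpose_vecMulVec]
  exact sum_vecMulVec_submatrix_swap_right w hpq

/-- Two distinct indices in `Fin (n + 1)` force `n ≠ 0`, so the entries of `u_r` are non-zero. -/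
private theorem ite_ne_zero {n : ℕ} {p q : Fin (n + 1)} (hpq : p ≠ q) (r j : Fin (n + 1)) :
    (if j = r then -(n : ℂ) else 1) ≠ 0 := by
  have hn : n ≠ 0 := by rintro rfl; exact hpq (Fin.ext (by have := p.isLt; have := q.isLt; omega))
  split_ifs <;> simp [hn]

/-- **No window-stable annihilating subspace** (size `n + 1`, from a non-zero member `A ∈ W`).
(A) some column `j₀` has two different entries `A i₀ j₀ ≠ A i₁ j₀`: the row difference
`(e_{i₀} - e_{i₁}) δᵀ`, row-symmetrised to `u δᵀ ∈ W`; either `δ` is constant (`≠ 0`) or a column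
difference, column-symmetrised, gives `(c u) u'ᵀ ∈ W`.  (B) all columns constant: `A = 𝟙 aᵀ`, `a ≠ 0`;
either `a` is constant or a column difference, symmetrised, gives `c 𝟙 u'ᵀ ∈ W`.  Rank one ⇒ `per ≠ 0`. -/
theorem exists_permanent_ne_zero_of_mem {n : ℕ} {W : Submodule ℂ (Matrix (Fin (n + 1)) (Fin (n + 1)) ℂ)}
    (hW : ∀ σ τ : Equiv.Perm (Fin (n + 1)), ∀ A ∈ W, A.submatrix σ τ ∈ W)
    {A : Matrix (Fin (n + 1)) (Fin (n + 1)) ℂ} (hA : A ∈ W) (hA0 : A ≠ 0) :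
    ∃ B ∈ W, B.permanent ≠ 0 := by
  have hfact : ((Fintype.card (Fin (n + 1))).factorial : ℂ) ≠ 0 :=
    Nat.cast_ne_zero.mpr (Nat.factorial_ne_zero _)
  by_cases hcol : ∃ j₀ i₀ i₁, A i₀ j₀ ≠ A i₁ j₀
  · obtain ⟨j₀, i₀, i₁, hne⟩ := hcol
    have h01 : i₀ ≠ i₁ := fun h => hne (by rw [h])
    have hD : vecMulVec (fun i => if i = i₁ then -(n : ℂ) else 1) (fun j => A i₀ j - A i₁ j) ∈ W := by
      rw [← sum_vecMulVec_submatrix_swap_left _ h01]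
      refine W.sum_mem fun a _ => hW _ _ _ ?_
      rw [← sub_submatrix_swap_left A i₀ i₁]
      exact W.sub_mem hA (hW _ _ A hA)
    by_cases hδ : ∃ j₁, A i₀ j₁ - A i₁ j₁ ≠ A i₀ j₀ - A i₁ j₀
    · obtain ⟨j₁, hj₁⟩ := hδ
      have hj01 : j₀ ≠ j₁ := fun h => hj₁ (by rw [h])
      have hF : vecMulVec
          (fun i => (if i = i₁ then -(n : ℂ) else 1) * ((A i₀ j₀ - A i₁ j₀) - (A i₀ j₁ - A i₁ j₁)))
          (Pi.single j₀ 1 - Pi.single j₁ 1) ∈ W := by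
        have h1 := W.sub_mem hD (hW (Equiv.refl _) (Equiv.swap j₀ j₁) _ hD)
        rw [sub_submatrix_swap_right] at h1
        simpa only [vecMulVec_apply, ← mul_sub] using h1
      have hU : vecMulVec
          (fun i => (if i = i₁ then -(n : ℂ) else 1) * ((A i₀ j₀ - A i₁ j₀) - (A i₀ j₁ - A i₁ j₁)))
          (fun j => if j = j₁ then -(n : ℂ) else 1) ∈ W := by
        rw [← sum_vecMulVec_submatrix_swap_right _ hj01]
        exact W.sum_mem fun a _ => hW _ _ _ hF
      refine ⟨_, hU, ?_⟩
      rw [permanent_vecMulVec]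
      exact mul_ne_zero hfact (mul_ne_zero
        (Finset.prod_ne_zero_iff.mpr fun i _ =>
          mul_ne_zero (ite_ne_zero h01 i₁ i) (sub_ne_zero.mpr hj₁.symm))
        (Finset.prod_ne_zero_iff.mpr fun j _ => ite_ne_zero hj01 j₁ j))
    · push Not at hδ
      refine ⟨_, hD, ?_⟩
      rw [permanent_vecMulVec]
      exact mul_ne_zero hfact (mul_ne_zero
        (Finset.prod_ne_zero_iff.mpr fun i _ => ite_ne_zero h01 i₁ i)
        (Finset.prod_ne_zero_iff.mpr fun j _ => by rw [hδ j]; exact sub_ne_zero.mpr hne))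
  · push Not at hcol
    have hA1 : A = vecMulVec (fun _ => (1 : ℂ)) (fun j => A 0 j) := by
      ext i j
      rw [vecMulVec_apply, one_mul]
      exact hcol j i 0
    obtain ⟨i, j₀, ha⟩ : ∃ i j, A i j ≠ 0 := by
      by_contra h
      push Not at h
      exact hA0 (Matrix.ext fun i j => h i j)
    rw [hcol j₀ i 0] at ha
    by_cases hcst : ∃ j₁, A 0 j₁ ≠ A 0 j₀
    · obtain ⟨j₁, hj₁⟩ := hcst
      have hj01 : j₀ ≠ j₁ := fun h => hj₁ (by rw [h])
      have hE : vecMulVec (fun _ : Fin (n + 1) => A 0 j₀ - A 0 j₁) (Pi.single j₀ 1 - Pi.single j₁ 1) ∈ W := by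
        have h1 := W.sub_mem hA (hW (Equiv.refl _) (Equiv.swap j₀ j₁) A hA)
        have h2 : (fun i => A i j₀ - A i j₁) = fun _ => A 0 j₀ - A 0 j₁ :=
          funext fun i => by rw [hcol j₀ i 0, hcol j₁ i 0]
        rw [sub_submatrix_swap_right, h2] at h1
        exact h1
      have hU : vecMulVec (fun _ : Fin (n + 1) => A 0 j₀ - A 0 j₁)
          (fun j => if j = j₁ then -(n : ℂ) else 1) ∈ W := by
        rw [← sum_vecMulVec_submatrix_swap_right _ hj01]
        exact W.sum_mem fun a _ => hW _ _ _ hE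
      refine ⟨_, hU, ?_⟩
      rw [permanent_vecMulVec]
      exact mul_ne_zero hfact (mul_ne_zero
        (Finset.prod_ne_zero_iff.mpr fun _ _ => sub_ne_zero.mpr hj₁.symm)
        (Finset.prod_ne_zero_iff.mpr fun j _ => ite_ne_zero hj01 j₁ j))
    · push Not at hcst
      refine ⟨A, hA, ?_⟩
      rw [hA1, permanent_vecMulVec]
      exact mul_ne_zero hfact (mul_ne_zero (Finset.prod_ne_zero_iff.mpr fun _ _ => one_ne_zero)
        (Finset.prod_ne_zero_iff.mpr fun j _ => by rw [hcst j]; exact ha))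

/-- **No window-stable annihilating subspace.** A non-zero linear subspace of `m × m` matrices stable
under all `A ↦ A.submatrix σ τ` contains a matrix with non-zero permanent. -/
theorem exists_permanent_ne_zero_of_submatrix_stable {m : ℕ} (W : Submodule ℂ (Matrix (Fin m) (Fin m) ℂ))
    (hW : ∀ σ τ : Equiv.Perm (Fin m), ∀ A ∈ W, A.submatrix σ τ ∈ W) (hW0 : W ≠ ⊥) :
    ∃ A ∈ W, A.permanent ≠ 0 := by
  obtain ⟨A, hA, hA0⟩ := (Submodule.ne_bot_iff W).mp hW0
  cases m with
  | zero => exact ⟨A, hA, by rw [permanent_isEmpty]; exact one_ne_zero⟩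
  | succ n => exact exists_permanent_ne_zero_of_mem hW hA hA0

/-- A form of degree one is the linear functional of its degree-one coefficients
(`eval_eq_of_totalDegree_le_one` with vanishing constant term). -/
private theorem eval_eq_sum_of_isHomogeneous_one {σ : Type*} [Fintype σ] [DecidableEq σ]
    {p : MvPolynomial σ ℂ} (hp : p.IsHomogeneous 1) (x : σ → ℂ) :
    eval x p = ∑ i, coeff (Finsupp.single i 1) p * x i := by
  rw [eval_eq_of_totalDegree_le_one hp.totalDegree_le, hp.coeff_eq_zero (d := 0) (by simp), zero_add]

/-- **The first cut is everything.** A window-stable degree-`1` cut of `per_m` has `≥ m²` forms: fewer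
have a non-zero, window-stable common-zero subspace (rank–nullity), on which `per_m` would vanish. -/
theorem sq_le_of_hasIdealWidthLE_perPoly_one {m r : ℕ}
    (h : HasIdealWidthLE (biPermSubst m) (perPoly (Fin m) ℂ) 1 r) : m ^ 2 ≤ r := by
  classical
  obtain ⟨s, hcard, hhom, hstab, hmem⟩ := h
  by_contra hlt
  push Not at hlt
  let Φ : Matrix (Fin m) (Fin m) ℂ →ₗ[ℂ] (s → ℂ) :=
    { toFun := fun A p => ∑ ij : Fin m × Fin m,
        coeff (Finsupp.single ij 1) (p : MvPolynomial (Fin m × Fin m) ℂ) * A ij.1 ij.2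
      map_add' := fun A B => by
        funext p
        simp only [Pi.add_apply, Matrix.add_apply, mul_add, Finset.sum_add_distrib]
      map_smul' := fun c A => by
        funext p
        simp only [Pi.smul_apply, Matrix.smul_apply, smul_eq_mul, RingHom.id_apply, Finset.mul_sum]
        exact Finset.sum_congr rfl fun ij _ => by ring }
  have hΦ : ∀ A : Matrix (Fin m) (Fin m) ℂ,
      A ∈ LinearMap.ker Φ ↔ ∀ p ∈ s, eval (fun ij : Fin m × Fin m => A ij.1 ij.2) p = 0 := fun A => by
    rw [LinearMap.mem_ker, funext_iff, Subtype.forall]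
    exact forall₂_congr fun p hp => by rw [eval_eq_sum_of_isHomogeneous_one (hhom p hp)]; rfl
  have hker : LinearMap.ker Φ ≠ ⊥ := by
    intro hbot
    have h1 := LinearMap.finrank_range_add_finrank_ker Φ
    have h2 : Module.finrank ℂ (LinearMap.range Φ) ≤ s.card :=
      (Submodule.finrank_le _).trans_eq (by rw [Module.finrank_fintype_fun_eq_card, Fintype.card_coe])
    have h3 : Module.finrank ℂ (Matrix (Fin m) (Fin m) ℂ) = m ^ 2 := by
      rw [Module.finrank_matrix, Module.finrank_self, Fintype.card_fin, mul_one, sq]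
    rw [hbot, finrank_bot, add_zero, h3] at h1
    omega
  have hstabW : ∀ σ τ : Equiv.Perm (Fin m), ∀ A ∈ LinearMap.ker Φ,
      A.submatrix σ τ ∈ LinearMap.ker Φ := by
    intro σ τ A hA
    rw [hΦ] at hA ⊢
    intro p hp
    obtain ⟨γ, -, hγ⟩ :=
      permMatrix_mem_permSubst (k := ℂ) (σ := Fin m × Fin m) (Equiv.prodCongr σ.symm τ.symm)
    have hren : rename (Equiv.prodCongr σ τ) p ∈
        Submodule.span ℂ (s : Set (MvPolynomial (Fin m × Fin m) ℂ)) := by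
      have h1 := hstab γ (Subgroup.subset_closure ⟨σ.symm, τ.symm, hγ⟩) p hp
      rw [hγ, linSubst_permMatrix] at h1
      simpa only [Equiv.prodCongr_symm, Equiv.symm_symm] using h1
    have h0 := eval_eq_zero_of_mem_submoduleSpan hA hren
    rw [eval_rename] at h0
    exact h0
  obtain ⟨B, hB, hper⟩ := exists_permanent_ne_zero_of_submatrix_stable (LinearMap.ker Φ) hstabW hker
  apply hper
  have h0 := eval_eq_zero_of_mem_idealSpan (fun q hq => (hΦ B).mp hB q hq) hmem
  rw [eval_perPoly] at h0
  exact h0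

/-- **`idealWidth (biPermSubst m) per_m 1 = m²`** (`1 ≤ m`): the `d = 1` column of the leaf, exactly. -/
theorem idealWidth_perPoly_one_eq {m : ℕ} (hm : 1 ≤ m) :
    idealWidth (biPermSubst m) (perPoly (Fin m) ℂ) 1 = m ^ 2 := by
  refine le_antisymm (idealWidth_perPoly_one_le _ hm) ?_
  unfold idealWidth
  exact le_csInf ⟨m ^ 2, hasIdealWidthLE_perPoly_one _ hm⟩
    fun r hr => sq_le_of_hasIdealWidthLE_perPoly_one hr

end

end Summit.ValiantsHypothesis.ValiantsHypothesis.Theorems.EquivariantDialLayersCuts
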